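import Summits.AnomalousDissipation.AnomalousDissipation.Theorems.TaylorCertificatesEnsembleCeilingStubStarvedRide
import Summits.AnomalousDissipation.AnomalousDissipation.Theorems.TaylorCertificatePair.Negative.Modes
import Literature.Analysis.FluidPDE.StatisticalSolutionEnergyEq
import HarnessLib

/-!
# Reduction of `stub_f123EnsembleCeiling` to the fed exclusions (helper for crux
# stmt-AnomalousDissipation-13038, line `lamb-floor-f123-shared-ceiling`)

The shared ceiling stub of the line asks for a `ν`-uniform bound on the mean energy of every
stationary statistical solution (FMRT IV Def. 1.3, `Torus.IsStationaryStatisticalSolution`) of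
`NS_ν(f₁₂₃)`, `f₁₂₃ = (sin 2πx₃, sin 4πx₁, sin 6πx₂)`, below some `ν₀`.  This file proves, sorry-free,
the MEASURE-THEORETIC REDUCTION of that ceiling to the exclusion of FED tail states (a state `u ∈ H` is
fed at viscosity `ν` when `‖∇u‖² < ∞` and `ν‖∇u‖² ≤ (u, f)`), for EVERY smooth force `f`:

* `ensembleCeiling_of_fedTailExclusion` — if below `ν₀` no stationary statistical solution of `NS_ν(f)`
  charges a fed state of the tail `{R₀ ≤ |u|}`, then every such solution has mean energy `≤ (max R₀ 1)²`:
  starved states ride on fed ones (`stub_starvedRide`, landed: shell energy inequality (1.31) + (1.29)),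
  so the whole tail is null, `|u| < max R₀ 1` almost surely, and `μ` is a probability measure;
* `ensembleCeiling_of_fedExclusions` — the same with the tail exclusion split, as in the sibling crux
  `EnsembleCeiling` (line `sweep-test-cyclic-tlf-witness`), into a HOT rung (`θ/ν ≤ |u|`, every `θ > 0`)
  and a WARM rung (`R₀ ≤ |u| < θ₀/ν`, some `θ₀ > 0`);
* `stub_f123EnsembleCeiling_of_fedExclusions` — the instance at `f₁₂₃`: the two (open) fed exclusions
  `stub_fedHotExclusion`, `stub_fedWarmExclusion` of the sibling skeleton imply `stub_f123EnsembleCeiling`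
  verbatim.
-/

noncomputable section

-- `Summit.<Summit>.<Problem>` is the tree's mandated summit-side namespace (CONVENTIONS §2); single-conjunct summit, duplicate deliberate.
set_option linter.dupNamespace false

open MeasureTheory UnitAddTorus Matrix
open scoped InnerProductSpace ENNReal ComplexConjugate

namespace Summit.AnomalousDissipation.AnomalousDissipation.Theorems.SteadyStatesLoudBounded.F123EnsembleCeiling

open Literature.Analysis.FunctionSpaces Literature.Analysis.FluidPDE
open Summit.AnomalousDissipation.AnomalousDissipation.Theorems.TaylorCertificatePair.Negative
open Summit.AnomalousDissipation.AnomalousDissipation.Theorems.TaylorCertificatesEnsembleCeiling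


/-- **Ceiling from the fed-tail exclusion (every smooth force).**  If below `ν₀` no stationary
statistical solution of `NS_ν(f)` charges a fed state with `R₀ ≤ |u|`, then below `ν₀` every stationary
statistical solution with integrable energy has mean energy `≤ (max R₀ 1)²`. -/
theorem ensembleCeiling_of_fedTailExclusion {f : (UnitAddTorus (Fin 3) → EuclideanSpace ℝ (Fin 3))} (hf : Torus.IsSmooth f) {R₀ ν₀ : ℝ}
    (hTail : ∀ ν : ℝ, 0 < ν → ν < ν₀ →
      ∀ μ : Measure (Torus.energySpace (Fin 3)), Torus.IsStationaryStatisticalSolution ν f μ →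
        μ {u : (Torus.energySpace (Fin 3)) | R₀ ≤ ‖u‖ ∧ (Torus.eGradNormSq (((u : (Torus.energySpace (Fin 3))) : (Lp (EuclideanSpace ℝ (Fin 3)) 2 (volume : Measure (UnitAddTorus (Fin 3))))) : (UnitAddTorus (Fin 3) → EuclideanSpace ℝ (Fin 3))) ≠ ⊤ ∧ ν * ENNReal.toReal (Torus.eGradNormSq (((u : (Torus.energySpace (Fin 3))) : (Lp (EuclideanSpace ℝ (Fin 3)) 2 (volume : Measure (UnitAddTorus (Fin 3))))) : (UnitAddTorus (Fin 3) → EuclideanSpace ℝ (Fin 3)))) ≤ Torus.pairing ((u : (Torus.energySpace (Fin 3))) : (Lp (EuclideanSpace ℝ (Fin 3)) 2 (volume : Measure (UnitAddTorus (Fin 3))))) f)} = 0) :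
    ∀ ν : ℝ, 0 < ν → ν < ν₀ →
      ∀ μ : Measure (Torus.energySpace (Fin 3)), Torus.IsStationaryStatisticalSolution ν f μ →
        Integrable (fun v : (Torus.energySpace (Fin 3)) => ‖v‖ ^ 2) μ → Torus.ensembleEnergy μ ≤ (max R₀ 1) ^ 2 := by
  intro ν hν hνlt μ hμ hint
  have ha : (0 : ℝ) < max R₀ 1 := lt_of_lt_of_le one_pos (le_max_right _ _)
  -- the fed part of the tail `{max R₀ 1 ≤ |u|}` lies in the excluded fed tail `{R₀ ≤ |u|}`
  have hsub : {u : (Torus.energySpace (Fin 3)) | max R₀ 1 ≤ ‖u‖ ∧ (Torus.eGradNormSq (((u : (Torus.energySpace (Fin 3))) : (Lp (EuclideanSpace ℝ (Fin 3)) 2 (volume : Measure (UnitAddTorus (Fin 3))))) : (UnitAddTorus (Fin 3) → EuclideanSpace ℝ (Fin 3))) ≠ ⊤ ∧ ν * ENNReal.toReal (Torus.eGradNormSq (((u : (Torus.energySpace (Fin 3))) : (Lp (EuclideanSpace ℝ (Fin 3)) 2 (volume : Measure (UnitAddTorus (Fin 3))))) : (UnitAddTorus (Fin 3) → EuclideanSpace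 ℝ (Fin 3)))) ≤ Torus.pairing ((u : (Torus.energySpace (Fin 3))) : (Lp (EuclideanSpace ℝ (Fin 3)) 2 (volume : Measure (UnitAddTorus (Fin 3))))) f)} ⊆ {u : (Torus.energySpace (Fin 3)) | R₀ ≤ ‖u‖ ∧ (Torus.eGradNormSq (((u : (Torus.energySpace (Fin 3))) : (Lp (EuclideanSpace ℝ (Fin 3)) 2 (volume : Measure (UnitAddTorus (Fin 3))))) : (UnitAddTorus (Fin 3) → EuclideanSpace ℝ (Fin 3))) ≠ ⊤ ∧ ν * ENNReal.toReal (Torus.eGradNormSq (((u : (Torus.energySpace (Fin 3))) : (Lp (EuclideanSpace ℝ (Fin 3)) 2 (volume : Measure (UnitAddTorus (Fin 3))))) : (UnitAddTorus (Fin 3) → EuclideanSpace ℝ (Fin 3)))) ≤ Torus.pairing ((u : (Torus.energySpace (Fin 3))) : (Lp (EuclideanSpace ℝ (Fin 3)) 2 (volume : Measure (UnitAddTorus (Fin 3))))) f)} := by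
    rintro u ⟨hau, hfu⟩
    exact ⟨le_trans (le_max_left _ _) hau, hfu⟩
  have hfed : μ {u : (Torus.energySpace (Fin 3)) | max R₀ 1 ≤ ‖u‖ ∧ (Torus.eGradNormSq (((u : (Torus.energySpace (Fin 3))) : (Lp (EuclideanSpace ℝ (Fin 3)) 2 (volume : Measure (UnitAddTorus (Fin 3))))) : (UnitAddTorus (Fin 3) → EuclideanSpace ℝ (Fin 3))) ≠ ⊤ ∧ ν * ENNReal.toReal (Torus.eGradNormSq (((u : (Torus.energySpace (Fin 3))) : (Lp (EuclideanSpace ℝ (Fin 3)) 2 (volume : Measure (UnitAddTorus (Fin 3))))) : (UnitAddTorus (Fin 3) → EuclideanSpace ℝ (Fin 3)))) ≤ Torus.pairing ((u : (Torus.energySpace (Fin 3))) : (Lp (EuclideanSpace ℝ (Fin 3)) 2 (volume : Measure (UnitAddTorus (Fin 3))))) f)} = 0 :=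
    measure_mono_null hsub (hTail ν hν hνlt μ hμ)
  -- starved states ride on fed ones: the whole tail is null
  have htail : μ {u : (Torus.energySpace (Fin 3)) | max R₀ 1 ≤ ‖u‖} = 0 := stub_starvedRide ν hν f hf μ hμ (max R₀ 1) ha hfed
  have hae : ∀ᵐ u ∂μ, ‖u‖ ^ 2 ≤ (max R₀ 1) ^ 2 := by
    filter_upwards [measure_eq_zero_iff_ae_notMem.1 htail] with u hu
    simp only [not_le] at hu
    exact pow_le_pow_left₀ (norm_nonneg _) hu.le 2
  haveI := hμ.prob
  unfold Torus.ensembleEnergy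
  calc ∫ u, ‖u‖ ^ 2 ∂μ ≤ ∫ _u, (max R₀ 1) ^ 2 ∂μ := integral_mono_ae hint (integrable_const _) hae
    _ = (max R₀ 1) ^ 2 := by simp

/-- **Ceiling from the hot and warm fed exclusions (every smooth force).**  The fed tail
`{max R₀ 1 ≤ |u|, fed}` is covered by the warm window `{R₀ ≤ |u| < θ₀/ν, fed}` and the hot region
`{θ₀/ν ≤ |u|, fed}`; if both are null for every stationary statistical solution below `ν₀`, resp.
`ν₀(θ₀)`, the ceiling holds with `E = (max R₀ 1)²` below `min ν₀ ν₀(θ₀)`. -/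
theorem ensembleCeiling_of_fedExclusions {f : (UnitAddTorus (Fin 3) → EuclideanSpace ℝ (Fin 3))} (hf : Torus.IsSmooth f)
    (hHot : ∀ θ : ℝ, 0 < θ → ∃ ν₀ : ℝ, 0 < ν₀ ∧ ∀ ν : ℝ, 0 < ν → ν < ν₀ →
      ∀ μ : Measure (Torus.energySpace (Fin 3)), Torus.IsStationaryStatisticalSolution ν f μ →
        μ {u : (Torus.energySpace (Fin 3)) | θ / ν ≤ ‖u‖ ∧ (Torus.eGradNormSq (((u : (Torus.energySpace (Fin 3))) : (Lp (EuclideanSpace ℝ (Fin 3)) 2 (volume : Measure (UnitAddTorus (Fin 3))))) : (UnitAddTorus (Fin 3) → EuclideanSpace ℝ (Fin 3))) ≠ ⊤ ∧ ν * ENNReal.toReal (Torus.eGradNormSq (((u : (Torus.energySpace (Fin 3))) : (Lp (EuclideanSpace ℝ (Fin 3)) 2 (volume : Measure (UnitAddTorus (Fin 3))))) : (UnitAddTorus (Fin 3) → EuclideanSpace ℝ (Fin 3)))) ≤ Torus.pairing ((u : (Torus.energySpace (Fin 3))) : (Lp (EuclideanSpace ℝ (Fin 3)) 2 (volume : Measure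 (UnitAddTorus (Fin 3))))) f)} = 0)
    (hWarm : ∃ θ₀ : ℝ, 0 < θ₀ ∧ ∃ (R₀ ν₀ : ℝ), 0 < ν₀ ∧ ∀ ν : ℝ, 0 < ν → ν < ν₀ →
      ∀ μ : Measure (Torus.energySpace (Fin 3)), Torus.IsStationaryStatisticalSolution ν f μ →
        μ {u : (Torus.energySpace (Fin 3)) | R₀ ≤ ‖u‖ ∧ ‖u‖ < θ₀ / ν ∧ (Torus.eGradNormSq (((u : (Torus.energySpace (Fin 3))) : (Lp (EuclideanSpace ℝ (Fin 3)) 2 (volume : Measure (UnitAddTorus (Fin 3))))) : (UnitAddTorus (Fin 3) → EuclideanSpace ℝ (Fin 3))) ≠ ⊤ ∧ ν * ENNReal.toReal (Torus.eGradNormSq (((u : (Torus.energySpace (Fin 3))) : (Lp (EuclideanSpace ℝ (Fin 3)) 2 (volume : Measure (UnitAddTorus (Fin 3))))) : (UnitAddTorus (Fin 3) → EuclideanSpace ℝ (Fin 3)))) ≤ Torus.pairing ((u : (Torus.energySpace (Fin 3))) : (Lp (EuclideanSpace ℝ (Fin 3)) 2 (volume : Measure (UnitAddTorus (Fin 3)))))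 f)} = 0) :
    ∃ (E ν₀ : ℝ), 0 < ν₀ ∧ ∀ ν : ℝ, 0 < ν → ν < ν₀ →
      ∀ μ : Measure (Torus.energySpace (Fin 3)), Torus.IsStationaryStatisticalSolution ν f μ →
        Integrable (fun v : (Torus.energySpace (Fin 3)) => ‖v‖ ^ 2) μ → Torus.ensembleEnergy μ ≤ E := by
  obtain ⟨θ₀, hθ₀, R₀, ν₁, hν₁, hW⟩ := hWarm
  obtain ⟨ν₂, hν₂, hH⟩ := hHot θ₀ hθ₀
  refine ⟨(max R₀ 1) ^ 2, min ν₁ ν₂, lt_min hν₁ hν₂, ensembleCeiling_of_fedTailExclusion hf ?_⟩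
  intro ν hν hνlt μ hμ
  have hν1 : ν < ν₁ := lt_of_lt_of_le hνlt (min_le_left _ _)
  have hν2 : ν < ν₂ := lt_of_lt_of_le hνlt (min_le_right _ _)
  -- the fed tail is covered by the warm window and the hot region
  have hsub : {u : (Torus.energySpace (Fin 3)) | R₀ ≤ ‖u‖ ∧ (Torus.eGradNormSq (((u : (Torus.energySpace (Fin 3))) : (Lp (EuclideanSpace ℝ (Fin 3)) 2 (volume : Measure (UnitAddTorus (Fin 3))))) : (UnitAddTorus (Fin 3) → EuclideanSpace ℝ (Fin 3))) ≠ ⊤ ∧ ν * ENNReal.toReal (Torus.eGradNormSq (((u : (Torus.energySpace (Fin 3))) : (Lp (EuclideanSpace ℝ (Fin 3)) 2 (volume : Measure (UnitAddTorus (Fin 3))))) : (UnitAddTorus (Fin 3) → EuclideanSpace ℝ (Fin 3)))) ≤ Torus.pairing ((u : (Torus.energySpace (Fin 3))) : (Lp (EuclideanSpace ℝ (Fin 3)) 2 (volume : Measure (UnitAddTorus (Fin 3))))) f)} ⊆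
      {u : (Torus.energySpace (Fin 3)) | R₀ ≤ ‖u‖ ∧ ‖u‖ < θ₀ / ν ∧ (Torus.eGradNormSq (((u : (Torus.energySpace (Fin 3))) : (Lp (EuclideanSpace ℝ (Fin 3)) 2 (volume : Measure (UnitAddTorus (Fin 3))))) : (UnitAddTorus (Fin 3) → EuclideanSpace ℝ (Fin 3))) ≠ ⊤ ∧ ν * ENNReal.toReal (Torus.eGradNormSq (((u : (Torus.energySpace (Fin 3))) : (Lp (EuclideanSpace ℝ (Fin 3)) 2 (volume : Measure (UnitAddTorus (Fin 3))))) : (UnitAddTorus (Fin 3) → EuclideanSpace ℝ (Fin 3)))) ≤ Torus.pairing ((u : (Torus.energySpace (Fin 3))) : (Lp (EuclideanSpace ℝ (Fin 3)) 2 (volume : Measure (UnitAddTorus (Fin 3))))) f)} ∪ {u : (Torus.energySpace (Fin 3)) | θ₀ / ν ≤ ‖u‖ ∧ (Torus.eGradNormSq (((u : (Torus.energySpace (Fin 3))) : (Lp (EuclideanSpace ℝ (Fin 3)) 2 (volume : Measure (UnitAddTorus (Fin 3))))) : (UnitAddTorus (Fin 3) → EuclideanSpace ℝ (Fin 3)))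 ≠ ⊤ ∧ ν * ENNReal.toReal (Torus.eGradNormSq (((u : (Torus.energySpace (Fin 3))) : (Lp (EuclideanSpace ℝ (Fin 3)) 2 (volume : Measure (UnitAddTorus (Fin 3))))) : (UnitAddTorus (Fin 3) → EuclideanSpace ℝ (Fin 3)))) ≤ Torus.pairing ((u : (Torus.energySpace (Fin 3))) : (Lp (EuclideanSpace ℝ (Fin 3)) 2 (volume : Measure (UnitAddTorus (Fin 3))))) f)} := by
    rintro u ⟨hau, hfu⟩
    by_cases hlt : ‖u‖ < θ₀ / ν
    · exact Or.inl ⟨hau, hlt, hfu⟩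
    · exact Or.inr ⟨not_lt.1 hlt, hfu⟩
  exact measure_mono_null hsub (measure_union_null (hW ν hν hν1 μ hμ) (hH ν hν hν2 μ hμ))

/-- **`stub_f123EnsembleCeiling` from the two fed exclusions of the sibling skeleton.**  The hot rung
(`stub_fedHotExclusion`: for every `θ > 0`, below some `ν₀(θ)` no stationary statistical solution of
`NS_ν((∑ mm, Torus.realTrigPoly {(![![0, 0, 1], ![2, 0, 0], ![0, 3, 0]] : Fin 3 → (Fin 3 → ℤ)) mm} (fun _ => (![(WithLp.toLp 2 ![-Complex.I, 0, 0] : EuclideanSpace ℂ (Fin 3)), (WithLp.toLp 2 ![0, -Complex.I, 0] : EuclideanSpace ℂ (Fin 3)), (WithLp.toLp 2 ![0, 0, -Complex.I] : EuclideanSpace ℂ (Fin 3))] : Fin 3 → EuclideanSpace ℂ (Fin 3)) mm)))` charges a fed state with `θ/ν ≤ |u|`) and the warm rung (`stub_fedWarmExclusion`: for some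
`θ₀ > 0`, `R₀`, `ν₀ > 0`, below `ν₀` none charges a fed state with `R₀ ≤ |u| < θ₀/ν`) imply the shared
ceiling stub of line `lamb-floor-f123-shared-ceiling` verbatim (this is the sibling composition
`ceilingAt_f123_of_stubs` with its ride hypothesis discharged by the landed `stub_starvedRide`). -/
theorem stub_f123EnsembleCeiling_of_fedExclusions : (∀ θ : ℝ, 0 < θ → ∃ ν₀ : ℝ, 0 < ν₀ ∧ ∀ ν : ℝ, 0 < ν → ν < ν₀ → ∀ μ : Measure (Torus.energySpace (Fin 3)), Torus.IsStationaryStatisticalSolution ν (∑ mm, Torus.realTrigPoly {(![![0, 0, 1], ![2, 0, 0], ![0, 3, 0]] : Fin 3 → (Fin 3 → ℤ)) mm} (fun _ => (![(WithLp.toLp 2 ![-Complex.I, 0, 0] : EuclideanSpace ℂ (Fin 3)), (WithLp.toLp 2 ![0, -Complex.I, 0] : EuclideanSpace ℂ (Fin 3)), (WithLp.toLp 2 ![0, 0, -Complex.I] : EuclideanSpace ℂ (Fin 3))] : Fin 3 → EuclideanSpace ℂ (Fin 3)) mm)) μ → μ {u : (Torus.energySpace (Fin 3)) | θ / ν ≤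 ‖u‖ ∧ (Torus.eGradNormSq (((u : (Torus.energySpace (Fin 3))) : (Lp (EuclideanSpace ℝ (Fin 3)) 2 (volume : Measure (UnitAddTorus (Fin 3))))) : (UnitAddTorus (Fin 3) → EuclideanSpace ℝ (Fin 3))) ≠ ⊤ ∧ ν * ENNReal.toReal (Torus.eGradNormSq (((u : (Torus.energySpace (Fin 3))) : (Lp (EuclideanSpace ℝ (Fin 3)) 2 (volume : Measure (UnitAddTorus (Fin 3))))) : (UnitAddTorus (Fin 3) → EuclideanSpace ℝ (Fin 3)))) ≤ Torus.pairing ((u : (Torus.energySpace (Fin 3))) : (Lp (EuclideanSpace ℝ (Fin 3)) 2 (volume : Measure (UnitAddTorus (Fin 3))))) (∑ mm, Torus.realTrigPoly {(![![0, 0, 1], ![2, 0, 0], ![0, 3, 0]] : Fin 3 → (Fin 3 → ℤ)) mm} (fun _ => (![(WithLp.toLp 2 ![-Complex.I, 0, 0] : EuclideanSpace ℂ (Fin 3)), (WithLp.toLp 2 ![0, -Complex.I, 0] : EuclideanSpace ℂ (Fin 3)), (WithLp.toLp 2 ![0, 0, -Complex.I] : EuclideanSpace ℂ (Fin 3))]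 : Fin 3 → EuclideanSpace ℂ (Fin 3)) mm)))} = 0) → (∃ θ₀ : ℝ, 0 < θ₀ ∧ ∃ (R₀ ν₀ : ℝ), 0 < ν₀ ∧ ∀ ν : ℝ, 0 < ν → ν < ν₀ → ∀ μ : Measure (Torus.energySpace (Fin 3)), Torus.IsStationaryStatisticalSolution ν (∑ mm, Torus.realTrigPoly {(![![0, 0, 1], ![2, 0, 0], ![0, 3, 0]] : Fin 3 → (Fin 3 → ℤ)) mm} (fun _ => (![(WithLp.toLp 2 ![-Complex.I, 0, 0] : EuclideanSpace ℂ (Fin 3)), (WithLp.toLp 2 ![0, -Complex.I, 0] : EuclideanSpace ℂ (Fin 3)), (WithLp.toLp 2 ![0, 0, -Complex.I] : EuclideanSpace ℂ (Fin 3))] : Fin 3 → EuclideanSpace ℂ (Fin 3)) mm)) μ → μ {u : (Torus.energySpace (Fin 3)) | R₀ ≤ ‖u‖ ∧ ‖u‖ < θ₀ / ν ∧ (Torus.eGradNormSq (((u : (Torus.energySpace (Fin 3))) : (Lp (EuclideanSpace ℝ (Fin 3)) 2 (volume : Measure (UnitAddTorus (Fin 3))))) : (UnitAddTorus (Fin 3)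 → EuclideanSpace ℝ (Fin 3))) ≠ ⊤ ∧ ν * ENNReal.toReal (Torus.eGradNormSq (((u : (Torus.energySpace (Fin 3))) : (Lp (EuclideanSpace ℝ (Fin 3)) 2 (volume : Measure (UnitAddTorus (Fin 3))))) : (UnitAddTorus (Fin 3) → EuclideanSpace ℝ (Fin 3)))) ≤ Torus.pairing ((u : (Torus.energySpace (Fin 3))) : (Lp (EuclideanSpace ℝ (Fin 3)) 2 (volume : Measure (UnitAddTorus (Fin 3))))) (∑ mm, Torus.realTrigPoly {(![![0, 0, 1], ![2, 0, 0], ![0, 3, 0]] : Fin 3 → (Fin 3 → ℤ)) mm} (fun _ => (![(WithLp.toLp 2 ![-Complex.I, 0, 0] : EuclideanSpace ℂ (Fin 3)), (WithLp.toLp 2 ![0, -Complex.I, 0] : EuclideanSpace ℂ (Fin 3)), (WithLp.toLp 2 ![0, 0, -Complex.I] : EuclideanSpace ℂ (Fin 3))] : Fin 3 → EuclideanSpace ℂ (Fin 3)) mm)))} = 0) → ∃ (E ν₀ : ℝ), 0 < ν₀ ∧ ∀ ν : ℝ, 0 < ν → ν < ν₀ → ∀ μ : Measure (Torus.energySpace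 (Fin 3)), Torus.IsStationaryStatisticalSolution ν (∑ mm, Torus.realTrigPoly {(![![0, 0, 1], ![2, 0, 0], ![0, 3, 0]] : Fin 3 → (Fin 3 → ℤ)) mm} (fun _ => (![(WithLp.toLp 2 ![-Complex.I, 0, 0] : EuclideanSpace ℂ (Fin 3)), (WithLp.toLp 2 ![0, -Complex.I, 0] : EuclideanSpace ℂ (Fin 3)), (WithLp.toLp 2 ![0, 0, -Complex.I] : EuclideanSpace ℂ (Fin 3))] : Fin 3 → EuclideanSpace ℂ (Fin 3)) mm)) μ → Integrable (fun v : (Torus.energySpace (Fin 3)) => ‖v‖ ^ 2) μ → Torus.ensembleEnergy μ ≤ E :=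
  fun hHot hWarm => ensembleCeiling_of_fedExclusions (isSmooth_modes _ _) hHot hWarm

end Summit.AnomalousDissipation.AnomalousDissipation.Theorems.SteadyStatesLoudBounded.F123EnsembleCeiling

end
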